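import Mathlib.Analysis.SpecialFunctions.Log.Base
import Literature.Analysis.FluidPDE.SelfSimilarLiouville
import Literature.Analysis.FluidPDE.DistributionalToWeak
import Literature.Analysis.FluidPDE.SpaceTimeRescaling
import HarnessLib

/-!
# Chae–Wolf's discretely self-similar local Leray solutions: representatives, the cut-off argument, Appendix B

Analysis/FluidPDE support file (definitions and proved theorems only, no named facts) for
Chae–Wolf, *Existence of discretely self-similar solutions to the Navier–Stokes equations for
initial value in `L²_loc(ℝ³)`*, Ann. Inst. H. Poincaré C 35 (2018) = arXiv:1610.01386,
**Theorem 1.4** with **Definition 1.2**, and Appendix B. Theorem 1.4 itself is vendored once, as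
the named fact `Literature.Analysis.FluidPDE.chaeWolf2018_dss_existence` of `SelfSimilarLiouville`
(the tree's weak-solution vocabulary: a `λ`-DSS field `u` on all of `ℝ × ℝ³`, `nsRescale λ u = u`
identically, which is a pressure-free weak solution *with datum* `IsWeakNSSolutionOn T 1 0 u₀ u`
for every `T > 0`, with the local energy class and the `L²_loc` attainment of the datum); its
printed form — Definition 1.2 (1)–(3) for a given field together with the discrete
self-similarity of every time slice (Lemma B.5 (B.9)) — is the predicate
`ChaeWolf2018.IsDSSLocalLeraySolution` of the sibling file `ChaeWolfLocalLerayProofs.lean`, which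
proves the two readings of Theorem 1.4 equivalent
(`chaeWolf2018_dss_existence_iff_isDSSLocalLeraySolution`). This file supplies the two soft steps
of that equivalence which the module docstring of `SelfSimilarLiouville` ("Forward DSS existence")
describes in words:

* (a) the passage from slice-wise a.e. self-similarity to an everywhere-`λ`-DSS representative
  (`dssRepr`, below: the representative differs from `u` on a null set of the open slab
  `(0,∞) × ℝ³` and slice-wise on null sets at every `t > 0`, so every clause transfers), and
* (b) the time cut-off argument turning the distributional identity of Definition 1.2 (2) on
  `ℝ³ × (0,∞)` plus the `L²_loc` attainment of the datum into Leray's weak identity with datum on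
  `[0, T)` (`weakIdentity_datum_of_divFree_distributional`, the divergence-free, pressure-free
  twin of the accepted `weakIdentity_datum_of_distributional` of `DistributionalToWeak`, same
  proof),

and Appendix B, Lemmas B.1–B.2, proved. (History, D-0026 review 2026-08-15: the printed form was
first vendored here as a closed named fact `chaeWolf2018_dss_localLeray_existence`; being Theorem
1.4 reworded — the tree proved it equivalent to `chaeWolf2018_dss_existence` — it was merged back
into that fact, its clauses becoming the predicate of the sibling file. The discharge of Theorem
1.4 is pursued along Bradshaw–Tsai 2019, `chaeWolf2018_dss_existence_of_bradshawTsai2019` and the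
`ForwardDSS*.lean` files; size XL directly: the Stokes pressure projection on `C²` domains, the
linear theory of §2 — Lemma 2.3, Theorem 2.2 —, Schauder's fixed point theorem and Aubin–Lions
compactness in §3.)

## Contents

* `dssIndex λ t = -⌊log_{λ²} t⌋` (the `k ∈ ℤ` with `λ²ᵏ t ∈ [1, λ²)`, `one_le_zpow_dssIndex_sq_mul`;
  shift law `dssIndex_mul_sq`) and the representative `dssRepr λ u` (`= λᵏ u(λ²ᵏt, λᵏx)`,
  `k = dssIndex λ t`, for `t > 0`; `0` for `t ≤ 0`): `λ`-DSS identically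
  (`isDiscretelySelfSimilar_dssRepr`); equal to `u(t)` a.e. at every `t > 0` under the slice
  hypothesis (B.9) (`dssRepr_slice_ae_eq`) and equal to `u` a.e. on the open slab
  (`dssRepr_ae_eq_slab`, via the general `ae_eq_prod_of_ae_slice_ae_eq` — slice-wise a.e. equal
  measurable functions on a product are a.e. equal — and
  `aestronglyMeasurable_uncurry_nsRescale`).
* `weakIdentity_datum_of_divFree_distributional` (general `E`, viscosity `ν`, force `f`) and
  `momentumIntegrand_eq_zero_of_notMem_Ioo`.
* Appendix B, proved: `chaeWolf2018_lemmaB1` (Lemma B.1: a.e. self-similarity (B.1) on the slab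
  gives `t ∈ M(u)` for a.e. `t > 0`, via the iteration `ae_eq_slab_nsRescale_zpow` of (B.1) to
  all `k ∈ ℤ`) and `chaeWolf2018_lemmaB2` (Lemma B.2: `t ∈ M(u) ↔ λ²t ∈ M(u)`).

## The printed statements (arXiv v1 numbering)

* Definition 1.2 (§1). `u₀ ∈ L²_loc(ℝ³)`; `u ∈ L²_{loc,σ}(ℝ³ × [0,∞))` is a *local Leray solution
  with projected pressure* if for every bounded `C²` domain `G` and `0 < T < ∞`:
  (1) `u ∈ V²_σ(G × (0,T)) ∩ C_w([0,T]; L²(G))`, `V² = L^∞(0,T; L²(G)) ∩ L²(0,T; W^{1,2}(G))`;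
  (2) for every `φ ∈ C_c^∞(Q)`, `Q = ℝ³ × (0,∞)`, with `∇·φ = 0`:
  `∫∫_Q (−u·∂ₜφ − u ⊗ u : ∇φ + ∇u : ∇φ) dx dt = 0`; (3) `u(t) → u₀` in `L²(G)` as `t → 0⁺`;
  (4) the local energy inequality with projected pressure (for `v_G = u + ∇p_{h,G}`,
  `∇p_{h,G} = −E*_G(u)`, `E*_G` the Stokes pressure projection of Remark 1.1).
* Theorem 1.4 (§1). For any `λ`-DSS initial datum `u₀ ∈ L²_{loc,σ}(ℝ³)` (`λ > 1`,
  `λ u₀(λx) = u₀(x)`) there exists at least one local Leray solution with projected pressure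
  `u ∈ L²_{loc,σ}(ℝ³ × [0,∞))` in the sense of Definition 1.2 which is discretely self-similar.
* Appendix B. A measurable `u` on `Q` is `λ`-DSS if `u(x,t) = λu(λx, λ²t)` for a.e. `(x,t) ∈ Q`
  ((B.1)); `M(u)` is the set of `t ≥ 0` with `u(x,t) = λᵏu(λᵏx, λ²ᵏt)` for a.e. `x` and all
  `k ∈ ℤ` ((B.2)); Lemma B.5: for a `λ`-DSS `u ∈ L^∞_loc([0,∞); L²_loc)` whose slices are in
  `L²_loc` and divergence free and which satisfies `∫_Q u ∂ₜφ = ∫_Q F : ∇φ + g·φ` for divergence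
  free `φ ∈ C_c^∞(Q)` with `F, g ∈ L¹(Q_R)` (for the solution of Theorem 1.4: `F = ∇u − u ⊗ u`,
  `g = 0`, by (2) and (1)), after redefinition on a null set of times
  `u ∈ C_w([0,∞); L²(B_R))` for all `R` and `M(u) = [0, ∞)` ((B.8)–(B.9)); two weakly continuous
  representatives agree at every time, so this is the representative of Definition 1.2 (1).

## Rendering of the printed clauses (used by `ChaeWolf2018.IsDSSLocalLeraySolution`)

`u : ℝ → ℝ³ → ℝ³` (time first), viscosity `1`, no force; "for every bounded `C²` domain `G`"
becomes "for every compact `K`" (every compact set lies in a ball); `u ∈ L²_loc(ℝ³ × [0,∞))` is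
joint a.e.-strong measurability on the open slab plus `∫_{(0,T)×K} |u|² < ∞`;
`u ∈ L^∞(0,T; L²(K))` is an `∀ᵐ t ∈ (0,T)` bound on `∫_K |u(t)|²`; `∇u ∈ L²((0,T) × K)` is a weak
spatial gradient `G` on the slab (`HasWeakSpatialGradientOn`, one `G` for all `K`, `T`: weak
gradients on overlapping cylinders agree a.e.) with `∫_{(0,T)×K} |G|² < ∞`; the index `σ` is weak
divergence-freeness of a.e. slice; (2) is written after the integration by parts
`∫∫ ∇u : ∇φ = −∫∫ u · Δφ` (valid for `∇u ∈ L²_loc`, `φ ∈ C_c^∞`) and multiplied by `−1`, i.e. in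
the form of the momentum identity of `IsDistributionalNSSolutionOn` without pressure, tested
against divergence-free fields (`u ⊗ u : ∇φ = ⟪u, (u·∇)φ⟫`); (3) is
`∫_K |u(t) − u₀|² → 0` along `t → 0⁺`; self-similarity is (B.9) at every `t > 0`:
`u(t, ·) = λᵏ u(λ²ᵏ t, λᵏ ·)` a.e., i.e. `u t =ᵐ nsRescale (λ ^ k) u t`, for all `k ∈ ℤ`.

## Mathlib / tree search

Mathlib has no Navier–Stokes or self-similarity notions; used: `Real.logb`, `Int.floor`,
`Measure.ae_prod_mem_iff_ae_ae_mem`, `Measure.ae_ae_of_ae_prod`,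
`AEStronglyMeasurable.comp_quasiMeasurePreserving`, `setIntegral_eq_of_subset_of_forall_sdiff_eq_zero`,
`tendsto_integral_of_dominated_convergence`. Tree: `nsRescale`, `IsDiscretelySelfSimilar`
(`SelfSimilar`); `stAffine`, `quasiMeasurePreserving_stAffine` (`SpaceTimeRescaling`); the
cut-off toolkit of `DistributionalToWeak` (`exists_smooth_time_cutoff`,
`IsSpaceTimeTestOn.cutoff`, `integrable_slab_inner`, `exists_ae_abs_pairing_sub_datum_le`,
`tendsto_setIntegral_mul_of_ae_tendsto`, …); `lean search 'dssRepr|DSSRepr|logb.*floor'`: nothing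
of the kind existed. Prior art found in review (p16908): `ae_eq_prod_of_ae_slice_ae_eq` is in
substance the accepted `Literature.Analysis.FunctionSpaces.ae_eq_uncurry_of_forall_mem_slice_ae`
(`FunctionSpaces/TestPairingLimits`, every-`t ∈ I` hypothesis, Lebesgue measure) and
`ae_eq_uncurry_of_forall_slice_ae` (`KochTataruFixedPoint`), stated here for general product
measures with an a.e.-`t` hypothesis; `volume_restrict_Ioi_slab_eq` is the `Ioi` instance of
`volume_restrict_prod_univ_eq_prod` (`KatoUniquenessDual`) and of `volume_restrict_slab_eq`
(`DistributionalToWeak`). Lebesgue quasi-invariance under `x ↦ a x`, `a ≠ 0`, is Mathlib's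
`Measure.quasiMeasurePreserving_smul` (`ae_comp_smul_of_ae` below is its one-line a.e. form; the
tree twin `BradshawTsai2019.ae_comp_smul` of `ForwardDSSRepresentative`, `γ > 0`, lives
downstream of this file; `ForwardDSSRepresentative` also identifies `dssRepr` with its
`dssExtend` for the slab `(0, λ²) × E`, `dssRepr_eq_dssExtend`).

## References

* D. Chae, J. Wolf, Ann. Inst. H. Poincaré C Anal. Non Linéaire 35 (2018) 1019–1039 =
  arXiv:1610.01386 (v1), Definition 1.2, Theorem 1.4, Appendix B ((B.1)–(B.3), Lemmas B.1,
  B.2, B.5). [ChaeWolf2018]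
* Z. Bradshaw, T.-P. Tsai, Analysis & PDE 12 (2019) = arXiv:1801.08060, Comments on Thm 1.2
  (relation to Chae–Wolf). [BradshawTsai2019]
* J. C. Robinson, J. L. Rodrigo, W. Sadowski, *The Three-Dimensional Navier–Stokes Equations*
  (CUP 2016), §3.1 (time integration by parts producing the datum term). [RobinsonRodrigoSadowski2016]
-/

noncomputable section

open _root_.MeasureTheory TopologicalSpace Set Function Filter _root_.Topology InnerProductSpace
  Metric
open scoped RealInnerProductSpace ENNReal NNReal Laplacian

namespace Literature.Analysis.FluidPDE

/-! ### The scaling index of a positive time -/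

section Index

/-- The **scaling index** of a time `t` for the factor `λ = c`: `dssIndex c t = -⌊log_{c²} t⌋`,
the unique integer `k` with `c²ᵏ t ∈ [1, c²)` when `t > 0` and `c > 1` (the fundamental domain
`[1, λ²)` of the discrete parabolic scaling `t ↦ λ² t`; Chae–Wolf 2018, Appendix B, (B.3):
`t ∈ M(u) ⇔ λ²ᵏ t ∈ M(u)`). Junk (but harmless) for `t ≤ 0`. [folklore] -/
def dssIndex (c t : ℝ) : ℤ :=
  -⌊Real.logb (c ^ 2) t⌋

/-- Unfolding `dssIndex`. [folklore] -/
theorem dssIndex_def (c t : ℝ) : dssIndex c t = -⌊Real.logb (c ^ 2) t⌋ :=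
  rfl

/-- **Shift law**: scaling the time by `c²` lowers the index by one,
`dssIndex c (c² t) = dssIndex c t - 1` (`c > 1`, `t ≠ 0`). [folklore] -/
theorem dssIndex_mul_sq {c t : ℝ} (hc : 1 < c) (ht : t ≠ 0) :
    dssIndex c (c ^ 2 * t) = dssIndex c t - 1 := by
  have hc2 : 1 < c ^ 2 := by nlinarith
  have hc2' : c ^ 2 ≠ 0 := by positivity
  rw [dssIndex, dssIndex, Real.logb_mul hc2' ht, Real.logb_self_eq_one hc2, add_comm,
    Int.floor_add_one]
  ring

/-- For `t > 0` and `c > 1` the rescaled time `c^(2k) t`, `k = dssIndex c t`, lies in the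
fundamental domain `[1, c²)`. [folklore] -/
theorem one_le_zpow_dssIndex_sq_mul {c t : ℝ} (hc : 1 < c) (ht : 0 < t) :
    1 ≤ (c ^ dssIndex c t) ^ 2 * t ∧ (c ^ dssIndex c t) ^ 2 * t < c ^ 2 := by
  have hc2 : 1 < c ^ 2 := by nlinarith
  have hc20 : 0 < c ^ 2 := by positivity
  have hfl : (⌊Real.logb (c ^ 2) t⌋ : ℝ) ≤ Real.logb (c ^ 2) t := Int.floor_le _
  have hlt : Real.logb (c ^ 2) t < (⌊Real.logb (c ^ 2) t⌋ : ℝ) + 1 := Int.lt_floor_add_one _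
  have hzpow : (c ^ dssIndex c t) ^ 2 = (c ^ 2) ^ (-⌊Real.logb (c ^ 2) t⌋) := by
    rw [dssIndex, ← zpow_natCast, ← zpow_mul, ← zpow_natCast, ← zpow_mul]
    congr 1
    push_cast
    ring
  have ht' : t = (c ^ 2) ^ Real.logb (c ^ 2) t := by
    rw [Real.rpow_logb hc20 hc2.ne' ht]
  have key : (c ^ dssIndex c t) ^ 2 * t =
      (c ^ 2) ^ (Real.logb (c ^ 2) t - ⌊Real.logb (c ^ 2) t⌋) := by
    rw [Real.rpow_sub hc20, Real.rpow_intCast, hzpow, zpow_neg, ← ht', inv_mul_eq_div]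
  rw [key]
  constructor
  · exact Real.one_le_rpow hc2.le (by linarith)
  · calc (c ^ 2) ^ (Real.logb (c ^ 2) t - ⌊Real.logb (c ^ 2) t⌋) < (c ^ 2) ^ (1 : ℝ) :=
          Real.rpow_lt_rpow_of_exponent_lt hc2 (by linarith)
      _ = c ^ 2 := Real.rpow_one _

end Index

/-! ### The representative -/

section Repr

variable {E : Type*} [NormedAddCommGroup E] [NormedSpace ℝ E]
variable {F : Type*} [NormedAddCommGroup F] [NormedSpace ℝ F]

/-- **The everywhere-DSS representative** of a space–time field `u : ℝ → E → F` for the factor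
`c`: for `t > 0` it is the rescaled field `nsRescale (c ^ k) u` read at `(t, x)` with
`k = dssIndex c t`, i.e. `cᵏ u(c²ᵏ t, cᵏ x)` with `c²ᵏ t ∈ [1, c²)`; for `t ≤ 0` it is `0`.
If the slices of `u` are `c`-DSS in the a.e. sense of Chae–Wolf 2018, (B.2) at every `t > 0`,
this changes each slice `u(t)`, `t > 0`, only on a null set (`dssRepr_slice_ae_eq`) and is
`c`-DSS identically (`isDiscretelySelfSimilar_dssRepr`). [folklore] -/
def dssRepr (c : ℝ) (u : ℝ → E → F) : ℝ → E → F := fun t x =>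
  if 0 < t then nsRescale (c ^ dssIndex c t) u t x else 0

/-- The representative at positive times. [folklore] -/
theorem dssRepr_of_pos (c : ℝ) (u : ℝ → E → F) {t : ℝ} (ht : 0 < t) :
    dssRepr c u t = nsRescale (c ^ dssIndex c t) u t := by
  funext x
  simp [dssRepr, ht]

/-- The representative vanishes at non-positive times. [folklore] -/
theorem dssRepr_of_nonpos (c : ℝ) (u : ℝ → E → F) {t : ℝ} (ht : t ≤ 0) : dssRepr c u t = 0 := by
  funext x
  simp [dssRepr, not_lt.2 ht]

/-- Pointwise form at positive times: `dssRepr c u t x = cᵏ • u (c²ᵏ t) (cᵏ x)`,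
`k = dssIndex c t`. [folklore] -/
theorem dssRepr_apply_of_pos (c : ℝ) (u : ℝ → E → F) {t : ℝ} (ht : 0 < t) (x : E) :
    dssRepr c u t x =
      (c ^ dssIndex c t) • u ((c ^ dssIndex c t) ^ 2 * t) ((c ^ dssIndex c t) • x) := by
  rw [dssRepr_of_pos c u ht, nsRescale_apply]

/-- **The representative is discretely self-similar identically**: for `c > 1`,
`nsRescale c (dssRepr c u) = dssRepr c u` on all of `ℝ × E` (at `t > 0` by the shift law
`dssIndex c (c²t) = dssIndex c t - 1`; at `t ≤ 0` both sides vanish). [folklore] -/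
theorem isDiscretelySelfSimilar_dssRepr {c : ℝ} (hc : 1 < c) (u : ℝ → E → F) :
    IsDiscretelySelfSimilar c (dssRepr c u) := by
  have hc0 : c ≠ 0 := (zero_lt_one.trans hc).ne'
  have hc2 : 0 < c ^ 2 := by positivity
  funext t x
  rw [nsRescale_apply]
  rcases le_or_gt t 0 with ht | ht
  · have ht' : c ^ 2 * t ≤ 0 := mul_nonpos_of_nonneg_of_nonpos hc2.le ht
    rw [dssRepr_of_nonpos c u ht, dssRepr_of_nonpos c u ht']
    simp
  · have ht' : 0 < c ^ 2 * t := mul_pos hc2 ht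
    rw [dssRepr_apply_of_pos c u ht', dssRepr_apply_of_pos c u ht, dssIndex_mul_sq hc ht.ne']
    set k : ℤ := dssIndex c t
    have hk : c ^ (k - 1) * c = c ^ k := by
      rw [zpow_sub_one₀ hc0, inv_mul_cancel_right₀ hc0]
    rw [smul_smul, smul_smul, mul_comm c (c ^ (k - 1)), hk]
    congr 2
    calc (c ^ (k - 1)) ^ 2 * (c ^ 2 * t) = (c ^ (k - 1) * c) ^ 2 * t := by ring
      _ = (c ^ k) ^ 2 * t := by rw [hk]

/-- **Slice-wise the representative is a modification on null sets.** If at every time `t > 0`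
the slice `u(t)` is `c`-DSS in the a.e. sense for all `k ∈ ℤ` — `u(t, x) = cᵏ u(c²ᵏt, cᵏx)` for
a.e. `x` (Chae–Wolf 2018, (B.2); for the weakly continuous representative of a DSS local Leray
solution this holds at *every* `t`, Lemma B.5, (B.9)) — then `dssRepr c u (t) = u(t)` a.e. for
every `t > 0`. [folklore] -/
theorem dssRepr_slice_ae_eq [MeasurableSpace E] {μ : Measure E} {c : ℝ} {u : ℝ → E → F}
    (h : ∀ t, 0 < t → ∀ k : ℤ, u t =ᵐ[μ] nsRescale (c ^ k) u t) {t : ℝ} (ht : 0 < t) :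
    dssRepr c u t =ᵐ[μ] u t := by
  rw [dssRepr_of_pos c u ht]
  exact (h t ht (dssIndex c t)).symm

end Repr

/-! ### A.e. equality on a product from a.e. equality of slices -/

section Slices

variable {α β G : Type*} [MeasurableSpace α] [MeasurableSpace β] [TopologicalSpace G]
  [MetrizableSpace G]

/-- **Slice-wise a.e. equal measurable functions are a.e. equal** (Tonelli). If `f` and `g` are
a.e.-strongly measurable for `μ ⊗ ν` and for `μ`-a.e. `a` the slices `f(a, ·)` and `g(a, ·)`
agree `ν`-a.e., then `f = g` `μ ⊗ ν`-a.e.: pass to strongly measurable representatives, whose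
coincidence set is measurable, and use `Measure.ae_prod_mem_iff_ae_ae_mem`. (Measurability of
both functions is essential.) [folklore] -/
theorem ae_eq_prod_of_ae_slice_ae_eq {μ : Measure α} {ν : Measure β} [SFinite ν]
    {f g : α × β → G} (hf : AEStronglyMeasurable f (μ.prod ν))
    (hg : AEStronglyMeasurable g (μ.prod ν))
    (h : ∀ᵐ a ∂μ, (fun b => f (a, b)) =ᵐ[ν] fun b => g (a, b)) : f =ᵐ[μ.prod ν] g := by
  have hf' := hf.ae_eq_mk
  have hg' := hg.ae_eq_mk
  have hS : MeasurableSet {z | hf.mk f z = hg.mk g z} :=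
    hf.stronglyMeasurable_mk.measurableSet_eq_fun hg.stronglyMeasurable_mk
  have h1 : ∀ᵐ a ∂μ, ∀ᵐ b ∂ν, f (a, b) = hf.mk f (a, b) := Measure.ae_ae_of_ae_prod hf'
  have h2 : ∀ᵐ a ∂μ, ∀ᵐ b ∂ν, g (a, b) = hg.mk g (a, b) := Measure.ae_ae_of_ae_prod hg'
  have h3 : ∀ᵐ a ∂μ, ∀ᵐ b ∂ν, (a, b) ∈ {z | hf.mk f z = hg.mk g z} := by
    filter_upwards [h, h1, h2] with a ha h1a h2a
    filter_upwards [ha, h1a, h2a] with b hb h1b h2b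
    show hf.mk f (a, b) = hg.mk g (a, b)
    rw [← h1b, ← h2b, hb]
  have h4 : ∀ᵐ z ∂(μ.prod ν), z ∈ {z | hf.mk f z = hg.mk g z} :=
    (Measure.ae_prod_mem_iff_ae_ae_mem hS).2 h3
  filter_upwards [h4, hf', hg'] with z hz hfz hgz
  rw [hfz, hgz]
  exact hz

end Slices

/-! ### Measurability of rescaled fields and of the representative on the open slab -/

section Slab

variable {E : Type*} [NormedAddCommGroup E] [InnerProductSpace ℝ E] [FiniteDimensional ℝ E]
  [MeasurableSpace E] [BorelSpace E]
variable {F : Type*} [NormedAddCommGroup F] [NormedSpace ℝ F]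

/-- The volume on the open slab `(0,∞) × E` is the product `dt|_(0,∞) ⊗ dx`. [folklore] -/
theorem volume_restrict_Ioi_slab_eq :
    (volume : Measure (ℝ × E)).restrict (Ioi 0 ×ˢ univ) =
      ((volume : Measure ℝ).restrict (Ioi 0)).prod (volume : Measure E) := by
  rw [Measure.volume_eq_prod, Measure.restrict_prod_eq_prod_univ]

/-- The parabolic dilation `(t, x) ↦ (a² t, a x)`, `a > 0`, maps the open slab `(0,∞) × E` to
itself and is quasi-measure-preserving for Lebesgue measure restricted to the slab. [folklore] -/
theorem quasiMeasurePreserving_stAffine_slab {a : ℝ} (ha : 0 < a) :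
    Measure.QuasiMeasurePreserving (stAffine (a ^ 2) a 0 (0 : E))
      ((volume : Measure (ℝ × E)).restrict (Ioi 0 ×ˢ univ))
      ((volume : Measure (ℝ × E)).restrict (Ioi 0 ×ˢ univ)) := by
  have ha2 : 0 < a ^ 2 := by positivity
  have hq := quasiMeasurePreserving_stAffine (E := E) ha2 ha 0 0
  refine ⟨hq.measurable, Measure.AbsolutelyContinuous.mk fun N hN hN0 => ?_⟩
  rw [Measure.map_apply hq.measurable hN, Measure.restrict_apply (hq.measurable hN)]
  rw [Measure.restrict_apply hN] at hN0
  have hsub : stAffine (a ^ 2) a 0 (0 : E) ⁻¹' N ∩ Ioi 0 ×ˢ univ ⊆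
      stAffine (a ^ 2) a 0 (0 : E) ⁻¹' (N ∩ Ioi 0 ×ˢ univ) := by
    rintro ⟨t, x⟩ ⟨hz, ht⟩
    refine ⟨hz, ?_⟩
    simp only [stAffine_apply, mem_prod, mem_Ioi, mem_univ, and_true, zero_add]
    exact mul_pos ha2 (by simpa using ht)
  exact measure_mono_null hsub (hq.preimage_null hN0)

/-- **Measurability of rescaled fields on the slab.** If `u` is a.e.-strongly measurable on the
open slab `(0,∞) × E`, so is `nsRescale a u`, `a > 0` (composition with the
quasi-measure-preserving parabolic dilation). [folklore] -/
theorem aestronglyMeasurable_uncurry_nsRescale {u : ℝ → E → F}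
    (hu : AEStronglyMeasurable (uncurry u) ((volume : Measure (ℝ × E)).restrict (Ioi 0 ×ˢ univ)))
    {a : ℝ} (ha : 0 < a) :
    AEStronglyMeasurable (uncurry (nsRescale a u))
      ((volume : Measure (ℝ × E)).restrict (Ioi 0 ×ˢ univ)) := by
  have h1 : uncurry (nsRescale a u) = fun z => a • (uncurry u ∘ stAffine (a ^ 2) a 0 (0 : E)) z := by
    funext z
    obtain ⟨t, x⟩ := z
    simp [nsRescale_apply, stAffine_apply]
  rw [h1]
  exact (hu.comp_quasiMeasurePreserving (quasiMeasurePreserving_stAffine_slab ha)).const_smul a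

/-- **The representative equals the field a.e. on the open slab.** Let `c > 1`, let `u` be
a.e.-strongly measurable on `(0,∞) × E`, and suppose every slice `u(t)`, `t > 0`, is `c`-DSS in
the a.e. sense for all `k ∈ ℤ` (Chae–Wolf 2018, (B.2), with `M(u) ⊇ (0,∞)` as in Lemma B.5).
Then `dssRepr c u = u` a.e. on the slab: by `ae_eq_prod_of_ae_slice_ae_eq` the countably many
identities `u = nsRescale (cᵏ) u` hold simultaneously off one null set of the slab, and at such a
point `dssRepr c u` picks one of them. [folklore] -/
theorem dssRepr_ae_eq_slab {c : ℝ} (hc : 1 < c) {u : ℝ → E → F}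
    (hu : AEStronglyMeasurable (uncurry u) ((volume : Measure (ℝ × E)).restrict (Ioi 0 ×ˢ univ)))
    (h : ∀ t, 0 < t → ∀ k : ℤ, u t =ᵐ[volume] nsRescale (c ^ k) u t) :
    uncurry (dssRepr c u) =ᵐ[(volume : Measure (ℝ × E)).restrict (Ioi 0 ×ˢ univ)] uncurry u := by
  have hc0 : 0 < c := zero_lt_one.trans hc
  -- each identity `u = nsRescale (c ^ k) u` holds a.e. on the slab
  have hk : ∀ k : ℤ, uncurry u =ᵐ[(volume : Measure (ℝ × E)).restrict (Ioi 0 ×ˢ univ)]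
      uncurry (nsRescale (c ^ k) u) := by
    intro k
    have hu' := aestronglyMeasurable_uncurry_nsRescale hu (zpow_pos hc0 k)
    rw [volume_restrict_Ioi_slab_eq] at hu' ⊢
    refine ae_eq_prod_of_ae_slice_ae_eq (volume_restrict_Ioi_slab_eq (E := E) ▸ hu) hu' ?_
    rw [ae_restrict_iff' measurableSet_Ioi]
    exact Eventually.of_forall fun t ht => h t ht k
  have hk' : ∀ᵐ z ∂((volume : Measure (ℝ × E)).restrict (Ioi 0 ×ˢ univ)),
      ∀ k : ℤ, uncurry u z = uncurry (nsRescale (c ^ k) u) z := ae_all_iff.2 hk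
  have hmem : ∀ᵐ z ∂((volume : Measure (ℝ × E)).restrict (Ioi 0 ×ˢ univ)),
      z ∈ Ioi (0 : ℝ) ×ˢ (univ : Set E) :=
    ae_restrict_mem (measurableSet_Ioi.prod MeasurableSet.univ)
  filter_upwards [hk', hmem] with z hz hzm
  obtain ⟨t, x⟩ := z
  have ht : 0 < t := by simpa using hzm
  show dssRepr c u t x = u t x
  rw [dssRepr_of_pos c u ht]
  exact (hz (dssIndex c t)).symm

/-- The representative is a.e.-strongly measurable on the open slab (it equals `u` a.e.
there). [folklore] -/
theorem aestronglyMeasurable_uncurry_dssRepr {c : ℝ} (hc : 1 < c) {u : ℝ → E → F}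
    (hu : AEStronglyMeasurable (uncurry u) ((volume : Measure (ℝ × E)).restrict (Ioi 0 ×ˢ univ)))
    (h : ∀ t, 0 < t → ∀ k : ℤ, u t =ᵐ[volume] nsRescale (c ^ k) u t) :
    AEStronglyMeasurable (uncurry (dssRepr c u))
      ((volume : Measure (ℝ × E)).restrict (Ioi 0 ×ˢ univ)) :=
  hu.congr (dssRepr_ae_eq_slab hc hu h).symm

end Slab


/-! ### The cut-off argument for pressure-free distributional solutions -/

section Cutoff

variable {E : Type*} [NormedAddCommGroup E] [InnerProductSpace ℝ E] [FiniteDimensional ℝ E]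
  [MeasurableSpace E] [BorelSpace E]
variable {T ν : ℝ} {f u : ℝ → E → E} {u₀ : E → E}

/-- **The cut-off argument, divergence-free (pressure-free) form.** Let `u` satisfy the
pressure-free momentum identity against all test fields *with divergence-free slices* on the
open slab `(0,T) × E`, with `u, ‖u‖²` and `f` integrable on the finite cylinders `(0,T) × K`,
a.e. slice of `u` measurable and locally `L²`, `u₀` measurable, and `u(t) → u₀` in `L²_loc` as
`t → 0⁺`. Then for every test field `ψ` on `(-∞, T) × E` with divergence-free slices
`∫₀ᵀ ∫ (⟪u, ∂ₜψ⟫ + ⟪u, (u·∇)ψ⟫ + ν ⟪u, Δψ⟫ + ⟪f, ψ⟫) + ∫ ⟪u₀, ψ(0)⟫ = 0`. Twin of the accepted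
`weakIdentity_datum_of_distributional` (pressure-explicit identity against all tests), with the
same proof: test with `η_δ(t) ψ(t,x)` — still divergence free slice-wise — and let `δ → 0`
(Robinson–Rodrigo–Sadowski 2016, §3.1, the time integration by parts producing `⟨u(0), φ(0)⟩`;
this is how Chae–Wolf's Definition 1.2 (2)+(3) yield Leray's weak form with datum). [cite: RobinsonRodrigoSadowski2016, §3.1 p. 58 (3.1)] -/
theorem weakIdentity_datum_of_divFree_distributional (hT : 0 < T)
    (hUK : ∀ K : Set E, IsCompact K → IntegrableOn (uncurry u) (Ioo 0 T ×ˢ K) volume ∧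
      IntegrableOn (fun z => ‖uncurry u z‖ ^ 2) (Ioo 0 T ×ˢ K) volume)
    (hmom : ∀ ψ : ℝ → E → E, IsSpaceTimeTestOn (slab E (Ioo 0 T) isOpen_Ioo) ψ →
      (∀ t, VectorCalculus.IsDivFree (ψ t)) →
      ∫ z in Ioo 0 T ×ˢ (univ : Set E), (⟪u z.1 z.2, timeDeriv ψ z.1 z.2⟫ +
        ⟪u z.1 z.2, convect (u z.1) (ψ z.1) z.2⟫ + ν * ⟪u z.1 z.2, Δ (ψ z.1) z.2⟫ +
        ⟪f z.1 z.2, ψ z.1 z.2⟫) = 0)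
    (hf : ∀ K : Set E, IsCompact K → IntegrableOn (uncurry f) (Ioo 0 T ×ˢ K) volume)
    (hgood : ∀ᵐ t ∂((volume : Measure ℝ).restrict (Ioo 0 T)),
      AEStronglyMeasurable (u t) (volume : Measure E) ∧
        ∀ n : ℕ, ∫⁻ x in closedBall (0 : E) n, ‖u t x‖ₑ ^ 2 < ∞)
    (hm₀ : AEStronglyMeasurable u₀ (volume : Measure E))
    (h₀ : ∀ K : Set E, IsCompact K →
      Tendsto (fun t => ∫⁻ x in K, ‖u t x - u₀ x‖ₑ ^ 2) (𝓝[>] 0) (𝓝 0))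
    {ψ : ℝ → E → E} (hψ : IsSpaceTimeTestOn (slab E (Iio T) isOpen_Iio) ψ)
    (hdiv : ∀ t, VectorCalculus.IsDivFree (ψ t)) :
    (∫ t in Ioo 0 T, ∫ x, (⟪u t x, timeDeriv ψ t x⟫ + ⟪u t x, convect (u t) (ψ t) x⟫ +
        ν * ⟪u t x, Δ (ψ t) x⟫ + ⟪f t x, ψ t x⟫)) + ∫ x, ⟪u₀ x, ψ 0 x⟫ = 0 := by
  -- the compact `x`-shadow of `ψ`, enlarged to a closed ball `K`
  obtain ⟨K₀, hK₀, hK₀t⟩ := hψ.exists_compact_slice_subset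
  obtain ⟨r, hr⟩ := hK₀.isBounded.subset_closedBall (0 : E)
  set n : ℕ := ⌈r⌉₊ with hn
  set K : Set E := closedBall (0 : E) n with hK_def
  have hK : IsCompact K := isCompact_closedBall _ _
  have hKt : ∀ t, tsupport (ψ t) ⊆ K := fun t =>
    (hK₀t t).trans (hr.trans (closedBall_subset_closedBall (Nat.le_ceil r)))
  have hψ0 : ∀ t x, x ∉ K → ψ t x = 0 := fun t x hx =>
    image_eq_zero_of_notMem_tsupport fun h' => hx (hKt t h')
  -- regularity of the test-field ingredients as functions on `ℝ × E`
  have cψ : Continuous (uncurry ψ) := hψ.contDiff.continuous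
  have cψ' : Continuous (uncurry (timeDeriv ψ)) := hψ.continuous_timeDeriv
  have cD : Continuous fun z : ℝ × E => fderiv ℝ (ψ z.1) z.2 := by
    have h := ((hψ.isSmoothSpaceTimeOn univ).fderiv_slice uniqueDiffOn_univ).continuousOn
    rw [univ_prod_univ, continuousOn_univ] at h
    exact h
  have cL : Continuous fun z : ℝ × E => Δ (ψ z.1) z.2 := by
    have h := ((hψ.isSmoothSpaceTimeOn univ).laplacian uniqueDiffOn_univ).continuousOn
    rw [univ_prod_univ, continuousOn_univ] at h
    exact h
  have hψd : ∀ t, Differentiable ℝ (ψ t) := fun t =>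
    (hψ.contDiff_slice t).differentiable (by simp)
  have hψ2 : ∀ t, ContDiff ℝ 2 (ψ t) := fun t => contDiff_infty.1 (hψ.contDiff_slice t) 2
  have hD0 : ∀ t x, x ∉ K → fderiv ℝ (ψ t) x = 0 := fun t x hx =>
    fderiv_of_notMem_tsupport ℝ fun h => hx (hKt t h)
  have hL0 : ∀ t x, x ∉ K → Δ (ψ t) x = 0 := fun t x hx =>
    laplacian_eq_zero_of_notMem_tsupport fun h => hx (hKt t h)
  have hψ'0 : ∀ t x, x ∉ K → timeDeriv ψ t x = 0 := fun t x hx =>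
    timeDeriv_eq_zero_of_forall (fun s => hψ0 s x hx) t
  -- integrability on the slab
  obtain ⟨hUK1, hUK2⟩ := hUK K hK
  have iA : Integrable (fun z : ℝ × E => ⟪u z.1 z.2, timeDeriv ψ z.1 z.2⟫)
      (((volume : Measure ℝ).restrict (Ioo 0 T)).prod (volume : Measure E)) :=
    integrable_slab_inner hK hUK1 cψ' hψ'0
  have iB : Integrable (fun z : ℝ × E => ⟪u z.1 z.2, convect (u z.1) (ψ z.1) z.2⟫)
      (((volume : Measure ℝ).restrict (Ioo 0 T)).prod (volume : Measure E)) :=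
    integrable_slab_inner_clm_apply hK hUK1 hUK2 cD hD0
  have iC : Integrable (fun z : ℝ × E => ⟪u z.1 z.2, Δ (ψ z.1) z.2⟫)
      (((volume : Measure ℝ).restrict (Ioo 0 T)).prod (volume : Measure E)) :=
    integrable_slab_inner hK hUK1 cL hL0
  have iF : Integrable (fun z : ℝ × E => ⟪f z.1 z.2, ψ z.1 z.2⟫)
      (((volume : Measure ℝ).restrict (Ioo 0 T)).prod (volume : Measure E)) :=
    integrable_slab_inner hK (hf K hK) cψ hψ0
  have iU : Integrable (fun z : ℝ × E => ⟪u z.1 z.2, ψ z.1 z.2⟫)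
      (((volume : Measure ℝ).restrict (Ioo 0 T)).prod (volume : Measure E)) :=
    integrable_slab_inner hK hUK1 cψ hψ0
  set Φ : ℝ × E → ℝ := fun z => ⟪u z.1 z.2, timeDeriv ψ z.1 z.2⟫ +
    ⟪u z.1 z.2, convect (u z.1) (ψ z.1) z.2⟫ + ν * ⟪u z.1 z.2, Δ (ψ z.1) z.2⟫ +
    ⟪f z.1 z.2, ψ z.1 z.2⟫ with hΦ
  have iΦ : Integrable Φ (((volume : Measure ℝ).restrict (Ioo 0 T)).prod (volume : Measure E)) :=
    ((iA.add iB).add (iC.const_mul ν)).add iF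
  -- the pairing `U(t) = ⟨u(t), ψ(t)⟩` and its a.e. limit at `0⁺`
  set U : ℝ → ℝ := fun t => ∫ x, ⟪u t x, ψ t x⟫ with hU_def
  set L : ℝ := ∫ x, ⟪u₀ x, ψ 0 x⟫ with hL_def
  have hUint : IntegrableOn U (Ioo 0 T) := iU.integral_prod_left
  have hgoodK : ∀ᵐ t ∂((volume : Measure ℝ).restrict (Ioo 0 T)),
      AEStronglyMeasurable (u t) (volume : Measure E) ∧ ∫⁻ x in K, ‖u t x‖ₑ ^ 2 < ∞ := by
    filter_upwards [hgood] with t ht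
    exact ⟨ht.1, ht.2 n⟩
  have hu₀ : ∫⁻ x in K, ‖u₀ x‖ₑ ^ 2 < ∞ := lintegral_datum_sq_lt_top hT hgoodK hm₀ (h₀ K hK)
  have hlim : ∀ ε > 0, ∃ τ > 0, ∀ᵐ t ∂((volume : Measure ℝ).restrict (Ioo 0 τ)), |U t - L| ≤ ε :=
    fun ε hε => exists_ae_abs_pairing_sub_datum_le hT hK hgoodK hm₀ hu₀ (h₀ K hK) cψ
      hψ.hasCompactSupport hψ0 hε
  -- the cut-offs `η k` with derivatives `ρ k`, at scale `δ k = T / (6 (k + 1))`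
  set δ : ℕ → ℝ := fun k => T / (6 * ((k : ℝ) + 1)) with hδ
  have hδ0 : ∀ k, 0 < δ k := fun k => by positivity
  have hδT : ∀ k, 3 * δ k ≤ T := fun k => by
    have hk : (0 : ℝ) ≤ k := Nat.cast_nonneg k
    have h1 : δ k ≤ T / 6 := by
      show T / (6 * ((k : ℝ) + 1)) ≤ T / 6
      exact div_le_div_of_nonneg_left hT.le (by norm_num) (by nlinarith)
    linarith
  have hδlim : Tendsto δ atTop (𝓝 0) := by
    have h1 : Tendsto (fun k : ℕ => (k : ℝ) + 1) atTop atTop :=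
      tendsto_atTop_add_const_right _ 1 tendsto_natCast_atTop_atTop
    have h2 : Tendsto (fun k : ℕ => 6 * ((k : ℝ) + 1)) atTop atTop :=
      h1.const_mul_atTop (by norm_num)
    exact tendsto_const_nhds.div_atTop h2
  obtain hcut : ∀ k, ∃ η ρ : ℝ → ℝ, ContDiff ℝ (⊤ : ℕ∞) η ∧ Continuous ρ ∧
      (∀ s, HasDerivAt η (ρ s) s) ∧ (∀ s, s ≤ δ k → η s = 0) ∧ (∀ s, 3 * δ k ≤ s → η s = 1) ∧
      (∀ s, η s ∈ Icc (0 : ℝ) 1) ∧ (∀ s, 0 ≤ ρ s) ∧ (∀ s, s ∉ Ioo (δ k) (3 * δ k) → ρ s = 0) ∧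
      ∫ s, ρ s = 1 := fun k => exists_smooth_time_cutoff (hδ0 k)
  choose η ρ hηs hρc hηρ hη0 hη1 hη01 hρ0 hρsupp hρ1 using hcut
  have hηabs : ∀ k s, |η k s| ≤ 1 := fun k s => by
    rw [abs_le]
    exact ⟨by linarith [(hη01 k s).1], (hη01 k s).2⟩
  have hρC : ∀ k, ∃ C, 0 ≤ C ∧ ∀ s, |ρ k s| ≤ C := fun k =>
    exists_abs_le_of_eq_zero_off_Ioo (hρc k) (hρsupp k)
  -- Step 1: the tested identity for each `k`
  have hAB : ∀ k, (∫ z, η k z.1 * Φ z ∂(((volume : Measure ℝ).restrict (Ioo 0 T)).prod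
      (volume : Measure E))) + ∫ t in Ioo 0 T, ρ k t * U t = 0 := by
    intro k
    obtain ⟨C, -, hC⟩ := hρC k
    have hψk : IsSpaceTimeTestOn (slab E (Ioo 0 T) isOpen_Ioo) (fun s x => η k s • ψ s x) :=
      hψ.cutoff (hδ0 k) (hηs k) (hη0 k)
    have hdivk : ∀ t, VectorCalculus.IsDivFree (fun x => η k t • ψ t x) := fun t x => by
      rw [divergence_fun_const_smul (hψd t x), hdiv t x, mul_zero]
    have key := hmom _ hψk hdivk
    have key' : ∫ z in Ioo 0 T ×ˢ (univ : Set E),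
        (ρ k z.1 * ⟪u z.1 z.2, ψ z.1 z.2⟫ + η k z.1 * Φ z) = 0 := by
      refine Eq.trans (setIntegral_congr_fun (measurableSet_Ioo.prod MeasurableSet.univ)
        fun z _ => ?_) key
      rw [hΦ]
      dsimp only
      rw [timeDeriv_cutoff (hηρ k) hψ.hasDerivAt_time, convect_fun_const_smul _ (hψd z.1 z.2),
        laplacian_fun_const_smul (hψ2 z.1)]
      simp only [inner_add_right, real_inner_smul_right]
      ring
    have iρU : Integrable (fun z : ℝ × E => ρ k z.1 * ⟪u z.1 z.2, ψ z.1 z.2⟫)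
        (((volume : Measure ℝ).restrict (Ioo 0 T)).prod (volume : Measure E)) :=
      integrable_time_mul iU (hρc k) hC
    have iηΦ : Integrable (fun z : ℝ × E => η k z.1 * Φ z)
        (((volume : Measure ℝ).restrict (Ioo 0 T)).prod (volume : Measure E)) :=
      integrable_time_mul iΦ (hηs k).continuous (hηabs k)
    rw [volume_restrict_slab_eq, integral_add iρU iηΦ, integral_prod _ iρU] at key'
    simp only [integral_const_mul] at key'
    rw [add_comm]
    exact key'
  -- Step 2: the limits `k → ∞`
  have hA : Tendsto (fun k => ∫ z, η k z.1 * Φ z ∂(((volume : Measure ℝ).restrict (Ioo 0 T)).prod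
      (volume : Measure E))) atTop
      (𝓝 (∫ z, Φ z ∂(((volume : Measure ℝ).restrict (Ioo 0 T)).prod (volume : Measure E)))) := by
    refine tendsto_integral_of_dominated_convergence (fun z => ‖Φ z‖)
      (fun k => (integrable_time_mul iΦ (hηs k).continuous (hηabs k)).aestronglyMeasurable)
      iΦ.norm (fun k => Eventually.of_forall fun z => ?_) ?_
    · rw [norm_mul, Real.norm_eq_abs]
      exact mul_le_of_le_one_left (norm_nonneg _) (hηabs k z.1)
    · have hmem : ∀ᵐ z ∂(((volume : Measure ℝ).restrict (Ioo 0 T)).prod (volume : Measure E)),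
          z ∈ Ioo 0 T ×ˢ (univ : Set E) := by
        rw [← volume_restrict_slab_eq]
        exact ae_restrict_mem (measurableSet_Ioo.prod MeasurableSet.univ)
      filter_upwards [hmem] with z hz
      have hz1 : 0 < z.1 := hz.1.1
      have h3 : Tendsto (fun k => 3 * δ k) atTop (𝓝 0) := by
        simpa using hδlim.const_mul 3
      have hev : ∀ᶠ k in atTop, 3 * δ k < z.1 := (tendsto_order.1 h3).2 _ hz1
      refine (tendsto_const_nhds (x := Φ z)).congr' ?_
      filter_upwards [hev] with k hk
      rw [hη1 k z.1 hk.le, one_mul]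
  have hB : Tendsto (fun k => ∫ t in Ioo 0 T, ρ k t * U t) atTop (𝓝 L) :=
    tendsto_setIntegral_mul_of_ae_tendsto hUint hlim hδlim hδ0 hδT hρc hρ0 hρsupp hρ1
  have hsum : (∫ z, Φ z ∂(((volume : Measure ℝ).restrict (Ioo 0 T)).prod (volume : Measure E))) +
      L = 0 :=
    tendsto_nhds_unique (hA.add hB) (by simpa only [hAB] using tendsto_const_nhds)
  rw [integral_prod _ iΦ] at hsum
  exact hsum

omit [FiniteDimensional ℝ E] [MeasurableSpace E] [BorelSpace E] in
/-- Outside the support of a space–time field its time derivative vanishes (local copy of the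
support lemma of `HeatDuhamelBack`, which is not imported here). [folklore] -/
private theorem timeDeriv_eq_zero_of_notMem_tsupport_uncurry' {ψ : ℝ → E → E} {t : ℝ} {x : E}
    (h : (t, x) ∉ tsupport (uncurry ψ)) : timeDeriv ψ t x = 0 := by
  have h0 : uncurry ψ =ᶠ[𝓝 (t, x)] 0 := notMem_tsupport_iff_eventuallyEq.1 h
  have hc : Continuous fun s : ℝ => (s, x) := continuous_id.prodMk continuous_const
  have h1 : (fun s => ψ s x) =ᶠ[𝓝 t] fun _ => (0 : E) := (hc.tendsto t).eventually h0
  rw [timeDeriv, h1.deriv_eq, deriv_const]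

omit [MeasurableSpace E] [BorelSpace E] in
/-- For a test field on the slab `(0,T) × E`, the pressure-free momentum integrand vanishes at
every point whose time is not in `(0, T)` (all slice ingredients `∂ₜψ`, `Dψ`, `Δψ`, `ψ` vanish
there). [folklore] -/
theorem momentumIntegrand_eq_zero_of_notMem_Ioo {ψ : ℝ → E → E}
    (hψ : IsSpaceTimeTestOn (slab E (Ioo 0 T) isOpen_Ioo) ψ) {t : ℝ} (ht : t ∉ Ioo 0 T)
    (w : E → E) (g : E → E) (x : E) :
    ⟪w x, timeDeriv ψ t x⟫ + ⟪w x, convect w (ψ t) x⟫ + ν * ⟪w x, Δ (ψ t) x⟫ + ⟪g x, ψ t x⟫ =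
      0 := by
  have hnot : ∀ y, (t, y) ∉ (slab E (Ioo 0 T) isOpen_Ioo : Set (ℝ × E)) := fun y hy =>
    ht (mem_slab.1 hy)
  have hzero : ψ t = 0 := funext fun y => hψ.apply_eq_zero (hnot y)
  have hsupp : (t, x) ∉ tsupport (uncurry ψ) := fun h => hnot x (hψ.tsupport_subset h)
  have hΔ : Δ (ψ t) x = 0 := by
    refine laplacian_eq_zero_of_notMem_tsupport ?_
    rw [hzero, (tsupport_eq_empty_iff (f := (0 : E → E))).2 rfl]
    exact notMem_empty x
  rw [timeDeriv_eq_zero_of_notMem_tsupport_uncurry' hsupp, hΔ, convect, hzero]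
  simp

end Cutoff

/-! ### Appendix B: a.e. self-similarity and the time sets `M(u)` (Lemmas B.1, B.2) -/

section AppendixB

variable {E : Type*} [NormedAddCommGroup E] [InnerProductSpace ℝ E] [FiniteDimensional ℝ E]
  [MeasurableSpace E] [BorelSpace E]
variable {F : Type*} [NormedAddCommGroup F] [NormedSpace ℝ F]

/-- **Transport of a.e. equality on the slab under the parabolic dilation**: if `f = g` a.e. on
`(0,∞) × E` then `nsRescale a f = nsRescale a g` a.e. there, `a > 0` (the dilation
`(t, x) ↦ (a²t, ax)` is quasi-measure-preserving on the slab). [folklore] -/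
theorem ae_eq_slab_nsRescale {f g : ℝ → E → F} {a : ℝ} (ha : 0 < a)
    (h : uncurry f =ᵐ[(volume : Measure (ℝ × E)).restrict (Ioi 0 ×ˢ univ)] uncurry g) :
    uncurry (nsRescale a f) =ᵐ[(volume : Measure (ℝ × E)).restrict (Ioi 0 ×ˢ univ)]
      uncurry (nsRescale a g) := by
  have h1 : ∀ w : ℝ → E → F, uncurry (nsRescale a w) =
      fun z => a • (uncurry w ∘ stAffine (a ^ 2) a 0 (0 : E)) z := fun w => by
    funext z
    obtain ⟨t, x⟩ := z
    simp [nsRescale_apply, stAffine_apply]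
  rw [h1 f, h1 g]
  filter_upwards [(quasiMeasurePreserving_stAffine_slab (E := E) ha).ae_eq_comp h] with z hz
  rw [hz]

/-- **Iteration of a.e. self-similarity** (Chae–Wolf 2018, proof of Lemma B.1: "since `u` is
discretely self-similar …"). If `u(x,t) = c u(cx, c²t)` for a.e. `(t, x)` in the slab
`(0,∞) × E` (`c > 0`; print's (B.1)), then `u(x,t) = cᵏ u(cᵏx, c²ᵏt)` a.e. in the slab for
every `k ∈ ℤ` (induction on `k`, transporting the identity along the dilations by `c` and
`c⁻¹`). [folklore] -/
theorem ae_eq_slab_nsRescale_zpow {c : ℝ} (hc : 0 < c) {u : ℝ → E → F}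
    (h : uncurry u =ᵐ[(volume : Measure (ℝ × E)).restrict (Ioi 0 ×ˢ univ)]
      uncurry (nsRescale c u)) (k : ℤ) :
    uncurry u =ᵐ[(volume : Measure (ℝ × E)).restrict (Ioi 0 ×ˢ univ)]
      uncurry (nsRescale (c ^ k) u) := by
  have hc0 : c ≠ 0 := hc.ne'
  -- one step down: `u = nsRescale c⁻¹ u` a.e.
  have hinv : uncurry u =ᵐ[(volume : Measure (ℝ × E)).restrict (Ioi 0 ×ˢ univ)]
      uncurry (nsRescale c⁻¹ u) := by
    have h2 := ae_eq_slab_nsRescale (inv_pos.2 hc) h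
    rw [← nsRescale_mul, mul_inv_cancel₀ hc0, nsRescale_one] at h2
    exact h2.symm
  -- from exponent `m` to `m + 1` and to `m - 1`
  have hup : ∀ m : ℤ, uncurry u =ᵐ[(volume : Measure (ℝ × E)).restrict (Ioi 0 ×ˢ univ)]
      uncurry (nsRescale (c ^ m) u) →
      uncurry u =ᵐ[(volume : Measure (ℝ × E)).restrict (Ioi 0 ×ˢ univ)]
      uncurry (nsRescale (c ^ (m + 1)) u) := fun m hm => by
    have h2 := ae_eq_slab_nsRescale hc hm
    rw [← nsRescale_mul, ← zpow_add_one₀ hc0] at h2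
    exact h.trans h2
  have hdown : ∀ m : ℤ, uncurry u =ᵐ[(volume : Measure (ℝ × E)).restrict (Ioi 0 ×ˢ univ)]
      uncurry (nsRescale (c ^ m) u) →
      uncurry u =ᵐ[(volume : Measure (ℝ × E)).restrict (Ioi 0 ×ˢ univ)]
      uncurry (nsRescale (c ^ (m - 1)) u) := fun m hm => by
    have h2 := ae_eq_slab_nsRescale (inv_pos.2 hc) hm
    rw [← nsRescale_mul, ← zpow_sub_one₀ hc0] at h2
    exact hinv.trans h2
  induction k using Int.induction_on with
  | zero => simp [nsRescale_one]
  | succ n ih => exact hup n ih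
  | pred n ih => exact hdown (-(n : ℤ)) ih

/-- **Chae–Wolf 2018, Lemma B.1** (*the set `[0,+∞) ∖ M(u)` is a set of Lebesgue measure
zero*), for the open time half-line. Let `u : ℝ → E → F` be `c`-DSS in the a.e. sense (B.1) on
the slab `(0,∞) × E`: `u(x,t) = c u(cx, c²t)` for a.e. `(t,x)`. Then for a.e. `t > 0` the slice
`u(t)` satisfies `u(t, x) = cᵏ u(c²ᵏ t, cᵏ x)` for a.e. `x` and **all** `k ∈ ℤ`, i.e.
`t ∈ M(u)` ((B.2)): iterate (B.1) to all `k` (`ae_eq_slab_nsRescale_zpow`), intersect the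
countably many full-measure sets, and disintegrate in time (Tonelli). Print assumes `u`
measurable and `λ > 1`; neither is needed here (`c > 0` and the a.e. identity suffice), and
print's closed half-line `[0, ∞)` differs from `(0, ∞)` by one more null set. [cite: ChaeWolf2018, Lemma B.1] -/
theorem chaeWolf2018_lemmaB1 {c : ℝ} (hc : 0 < c) {u : ℝ → E → F}
    (h : uncurry u =ᵐ[(volume : Measure (ℝ × E)).restrict (Ioi 0 ×ˢ univ)]
      uncurry (nsRescale c u)) :
    ∀ᵐ t ∂((volume : Measure ℝ).restrict (Ioi 0)), ∀ k : ℤ,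
      u t =ᵐ[(volume : Measure E)] nsRescale (c ^ k) u t := by
  have hall : ∀ᵐ z ∂((volume : Measure (ℝ × E)).restrict (Ioi 0 ×ˢ univ)), ∀ k : ℤ,
      uncurry u z = uncurry (nsRescale (c ^ k) u) z :=
    ae_all_iff.2 fun k => ae_eq_slab_nsRescale_zpow hc h k
  rw [volume_restrict_Ioi_slab_eq] at hall
  filter_upwards [Measure.ae_ae_of_ae_prod hall] with t ht k
  filter_upwards [ht] with x hx
  exact hx k

omit [NormedSpace ℝ F] in
/-- Transport of a.e. statements on `E` under the dilation `x ↦ a x`, `a ≠ 0`: Mathlib's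
`Measure.quasiMeasurePreserving_smul` (Lebesgue measure is quasi-invariant under non-zero
dilations, any add-Haar measure) transported to a.e. statements (`QuasiMeasurePreserving.ae`).
One-line wrapper, kept for the two call sites below; `BradshawTsai2019.ae_comp_smul`
(`ForwardDSSRepresentative`, `γ > 0`) is its twin downstream, a candidate for redirection here. [folklore] -/
theorem ae_comp_smul_of_ae {a : ℝ} (ha : a ≠ 0) {P : E → Prop}
    (h : ∀ᵐ x ∂(volume : Measure E), P x) : ∀ᵐ x ∂(volume : Measure E), P (a • x) :=
  (Measure.quasiMeasurePreserving_smul (volume : Measure E) ha).ae h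

/-- One direction of Lemma B.2 for an arbitrary factor `c > 0`: if the slice at time `t` is
self-similar for all `k ∈ ℤ` (`t ∈ M(u)`, (B.2)), so is the slice at time `c² t`: from `k = 1`,
`u(c²t, y) = c⁻¹ u(t, c⁻¹y)` a.e., and from `k + 1`, `u(t, c⁻¹y) = cᵏ⁺¹ u(c²ᵏ⁺²t, cᵏ y)` a.e.
(null sets are transported along `y ↦ c⁻¹ y`). [cite: ChaeWolf2018, Lemma B.2] -/
theorem forall_ae_eq_nsRescale_mul_sq {c : ℝ} (hc : 0 < c) {u : ℝ → E → F} {t : ℝ}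
    (h : ∀ k : ℤ, u t =ᵐ[(volume : Measure E)] nsRescale (c ^ k) u t) (k : ℤ) :
    u (c ^ 2 * t) =ᵐ[(volume : Measure E)] nsRescale (c ^ k) u (c ^ 2 * t) := by
  have hc0 : c ≠ 0 := hc.ne'
  have hci : c⁻¹ ≠ 0 := inv_ne_zero hc0
  have h1 := ae_comp_smul_of_ae hci (h 1)
  have hk := ae_comp_smul_of_ae hci (h (k + 1))
  filter_upwards [h1, hk] with y h1y hky
  rw [nsRescale_apply, zpow_one, smul_smul, mul_inv_cancel₀ hc0, one_smul] at h1y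
  -- `h1y : u t (c⁻¹ • y) = c • u (c ^ 2 * t) y`
  rw [nsRescale_apply, zpow_add_one₀ hc0, smul_smul, mul_assoc, mul_inv_cancel₀ hc0,
    mul_one] at hky
  -- `hky : u t (c⁻¹ • y) = (c ^ k * c) • u ((c ^ k * c) ^ 2 * t) (c ^ k • y)`
  rw [nsRescale_apply]
  have key : c • u (c ^ 2 * t) y = (c ^ k * c) • u ((c ^ k * c) ^ 2 * t) (c ^ k • y) :=
    h1y.symm.trans hky
  have key' := congrArg (fun w => c⁻¹ • w) key
  simp only [smul_smul, inv_mul_cancel₀ hc0, one_smul] at key'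
  rw [key']
  congr 1
  · rw [mul_comm (c ^ k) c, ← mul_assoc, inv_mul_cancel₀ hc0, one_mul]
  · ring_nf

/-- **Chae–Wolf 2018, Lemma B.2** (*for every `t ∈ [0,+∞)` it holds `t ∈ M(u)` iff
`λ²t ∈ M(u)`*): the slice of `u` at time `t` is self-similar for all `k ∈ ℤ` ((B.2)) iff the
slice at time `c²t` is (`c > 0`; the converse direction is the direct one for the factor `c⁻¹`
after re-indexing `k ↦ −k`). Valid at every real `t`. [cite: ChaeWolf2018, Lemma B.2] -/
theorem chaeWolf2018_lemmaB2 {c : ℝ} (hc : 0 < c) (u : ℝ → E → F) (t : ℝ) :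
    (∀ k : ℤ, u t =ᵐ[(volume : Measure E)] nsRescale (c ^ k) u t) ↔
      ∀ k : ℤ, u (c ^ 2 * t) =ᵐ[(volume : Measure E)] nsRescale (c ^ k) u (c ^ 2 * t) := by
  refine ⟨fun h k => forall_ae_eq_nsRescale_mul_sq hc h k, fun h k => ?_⟩
  have hc0 : c ≠ 0 := hc.ne'
  -- apply the direct direction with the factor `c⁻¹` at the time `c² t`
  have h' : ∀ m : ℤ, u (c ^ 2 * t) =ᵐ[(volume : Measure E)] nsRescale (c⁻¹ ^ m) u (c ^ 2 * t) :=
    fun m => by simpa only [inv_zpow'] using h (-m)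
  have := forall_ae_eq_nsRescale_mul_sq (inv_pos.2 hc) h' (-k)
  rwa [inv_zpow', neg_neg, ← mul_assoc, ← mul_pow, inv_mul_cancel₀ hc0, one_pow, one_mul] at this

end AppendixB

end Literature.Analysis.FluidPDE

end
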